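import Literature.Barriers.AtomisticToContinuum.TetrahedralFrustrationRogers
import Mathlib.Analysis.SpecialFunctions.PolarCoord
import Mathlib.Analysis.SpecialFunctions.Trigonometric.InverseDeriv
import Mathlib.Analysis.SpecialFunctions.Sqrt
import Mathlib.MeasureTheory.Integral.IntervalIntegral.FundThmCalculus
import HarnessLib

/-!
# The sector constant of Rogers's bound: `vol(B(0,1) ∩ T_g) = (3θ − π)/18` — proved

Topic `Literature/Barriers/AtomisticToContinuum`; provefact programme for
`Literature.Barriers.AtomisticToContinuum.Rogers1958_bound` (see
`TetrahedralFrustrationRogers.lean`,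
imported, which reduces Rogers's bound to the named facts `Rogers1964_dissection` and
`Rogers1964_orthoschemeSectorVolume`).  This file DISCHARGES the second one:

`Rogers1964_orthoschemeSectorVolume_holds : volume (ball 0 1 ∩ rogersSimplex 0 rogersOrthoscheme)
  = ENNReal.ofReal ((3 * tetDihedralAngle - π) / 18)`,

`θ = tetDihedralAngle = arccos (1/3)`.  Classically this is Girard's formula (the solid angle of
the regular tetrahedron at a vertex is `3θ − π`; the orthoscheme `T_g` is a sixth of the vertex
cone cut at the opposite face, which lies outside the unit ball), cf. Rogers: "it is clear from
the definition of `σₙ` … that `μ(S ∩ G)/μ(G) = σₙ`" with `σ₃ = √18 (cos⁻¹ ⅓ − π/3)`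
[Rogers1964, Ch. 7 §4 and Introduction §3].  We give a direct computation instead:

* Part 1 (`ball_inter_orthoscheme_eq_preimage`): in coordinates `(x, y, z)`,
  `B(0,1) ∩ T_g = {x² + y² + z² < 1, 0 ≤ z, √2 z ≤ y, √3 y ≤ x}` (the facet `x = 1` of `T_g`
  opposite the apex lies outside the ball); the coordinate map `E3 → ℝ × ℝ × ℝ` preserves volume
  (`measurePreserving_coordMap`).
* Part 2 (`volume_sectorRegion_eq_lintegral`): integrating out `x` (Fubini), the `x`-slices are
  the intervals `[√3 y, √(1 − y² − z²))` over the planar window `{0 ≤ z, √2 z ≤ y}`.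
* Part 3 (`lintegral_window`): polar coordinates `(y, z) = ρ (cos φ, sin φ)` in the window, which
  becomes `0 ≤ φ ≤ θ/2` (`window_iff`; `tan (θ/2) = 1/√2`, i.e. `cos (θ/2) = √2 sin (θ/2)`,
  `sin (θ/2) = 1/√3`), and Tonelli.
* Part 4 (`radial_lintegral`): `∫₀^∞ (ρ √(1 − ρ²) − u ρ²)₊ dρ = (1 − u/√(1 + u²))/3` for
  `u = √3 cos φ > 0` (fundamental theorem of calculus with the antiderivative
  `−(1 − ρ²)^{3/2}/3 − u ρ³/3` up to `ρ = 1/√(1 + u²)`, where the integrand changes sign).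
* Part 5 (`angular_lintegral`): `∫₀^{θ/2} (1 − √3 cos φ/√(1 + 3 cos² φ))/3 dφ
  = [φ − arcsin ((√3/2) sin φ)]₀^{θ/2} / 3 = (θ/2 − π/6)/3 = (3θ − π)/18`
  (`arcsin ((√3/2) · (1/√3)) = arcsin ½ = π/6`).

## References

* C. A. Rogers, *Packing and Covering*, Cambridge Tracts 54, CUP 1964 (`Rogers1964`), Ch. 7 §4
  (the canonical orthoscheme `G`, `μ(S ∩ G)/μ(G) = σₙ`) and Introduction §3 (`σ₃ = √18 (cos⁻¹ ⅓ −
  π/3) = 0.7797…`).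
* T. C. Hales, *Dense Sphere Packings*, CUP 2012 (`HalesDSP2012`), §6.2 (p. 150: "approximately
  0.7797").
-/

noncomputable section

open Real MeasureTheory Set
open scoped ENNReal

namespace Literature.Barriers.AtomisticToContinuum

/-- Euclidean `3`-space. -/
local notation "E3" => EuclideanSpace ℝ (Fin 3)

/-! ### Part 0. Trigonometry of `θ/2` and the angular window -/

/-- `θ/2`, half the dihedral angle of the regular tetrahedron (`≈ 0.6155 ≈ 35.26°`), the
angular width of the orthoscheme about its first edge. [folklore] -/
def halfTet : ℝ := tetDihedralAngle / 2

/-- `0 < θ/2`. [folklore] -/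
theorem halfTet_pos : 0 < halfTet := by
  have := tetDihedralAngle_bounds.1; unfold halfTet; linarith

/-- `θ/2 < π/2`. [folklore] -/
theorem halfTet_lt : halfTet < π / 2 := by
  have := tetDihedralAngle_bounds.2; have := pi_gt_d2; unfold halfTet; linarith

/-- `cos² (θ/2) = 2/3` (half-angle formula with `cos θ = 1/3`). [folklore] -/
theorem cos_halfTet_sq : cos halfTet ^ 2 = 2 / 3 := by
  have h := cos_sq halfTet
  rw [h, show 2 * halfTet = tetDihedralAngle by unfold halfTet; ring, cos_tetDihedralAngle]
  norm_num

/-- `0 < cos (θ/2)`. [folklore] -/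
theorem cos_halfTet_pos : 0 < cos halfTet :=
  cos_pos_of_mem_Ioo ⟨by linarith [halfTet_pos, pi_pos], halfTet_lt⟩

/-- `sin² (θ/2) = 1/3`. [folklore] -/
theorem sin_halfTet_sq : sin halfTet ^ 2 = 1 / 3 := by
  have := sin_sq_add_cos_sq halfTet; rw [cos_halfTet_sq] at this; linarith

/-- `0 < sin (θ/2)`. [folklore] -/
theorem sin_halfTet_pos : 0 < sin halfTet :=
  sin_pos_of_pos_of_lt_pi halfTet_pos (by linarith [halfTet_lt, pi_pos])

/-- `sin (θ/2) = 1/√3`. [folklore] -/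
theorem sin_halfTet : sin halfTet = (√3)⁻¹ := by
  have h3 : (√3)⁻¹ ^ 2 = 1 / 3 := by rw [inv_pow, sq_sqrt (by norm_num)]; norm_num
  have hpos : 0 < (√3)⁻¹ := by positivity
  nlinarith [sin_halfTet_sq, sin_halfTet_pos, sq_nonneg (sin halfTet - (√3)⁻¹),
    sq_nonneg (sin halfTet + (√3)⁻¹)]

/-- `cos (θ/2) = √2 sin (θ/2)`, i.e. `tan (θ/2) = 1/√2`. [folklore] -/
theorem cos_halfTet : cos halfTet = √2 * sin halfTet := by
  have h2 : (√2) ^ 2 = 2 := sq_sqrt (by norm_num)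
  have hc := cos_halfTet_pos
  have hs := sin_halfTet_pos
  have h2p : 0 < √2 := by positivity
  nlinarith [cos_halfTet_sq, sin_halfTet_sq, sq_nonneg (cos halfTet - √2 * sin halfTet),
    sq_nonneg (cos halfTet + √2 * sin halfTet), mul_pos h2p hs]

/-- **The angular window**: for `φ ∈ (−π, π)`, `0 ≤ sin φ ∧ √2 sin φ ≤ cos φ ↔ φ ∈ [0, θ/2]`.
[folklore] -/
theorem window_iff {φ : ℝ} (hφ : φ ∈ Ioo (-π) π) :
    (0 ≤ sin φ ∧ √2 * sin φ ≤ cos φ) ↔ φ ∈ Icc 0 halfTet := by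
  have h2p : 0 < √2 := by positivity
  constructor
  · rintro ⟨hs, hc⟩
    have hφ0 : 0 ≤ φ := by
      by_contra h
      push Not at h
      have : sin φ < 0 := sin_neg_of_neg_of_neg_pi_lt h hφ.1
      linarith
    refine ⟨hφ0, ?_⟩
    by_contra h
    push Not at h
    -- φ ∈ (φ₀, π): show √2 sin φ > cos φ
    rcases lt_or_ge φ (π / 2) with hlt | hge
    · -- both in (0, π/2): use strict monotonicity: cos φ < cos φ₀ = √2 sin φ₀ < √2 sin φ
      have h1 : cos φ < cos halfTet :=
        cos_lt_cos_of_nonneg_of_le_pi_div_two halfTet_pos.le hlt.le h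
      have h3 : sin halfTet < sin φ :=
        strictMonoOn_sin ⟨by linarith [halfTet_pos, pi_pos], halfTet_lt.le⟩
          ⟨by linarith [pi_pos], hlt.le⟩ h
      rw [cos_halfTet] at h1
      nlinarith
    · have h1 : cos φ ≤ 0 := cos_nonpos_of_pi_div_two_le_of_le hge (by linarith [hφ.2])
      have h3 : 0 < sin φ := sin_pos_of_pos_of_lt_pi (by linarith [pi_pos]) hφ.2
      nlinarith
  · rintro ⟨h0, h1⟩
    have hlt : φ < π / 2 := lt_of_le_of_lt h1 halfTet_lt
    refine ⟨sin_nonneg_of_nonneg_of_le_pi h0 (by linarith [pi_pos]), ?_⟩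
    have hc : cos halfTet ≤ cos φ :=
      cos_le_cos_of_nonneg_of_le_pi h0 (by linarith [halfTet_lt, pi_pos]) h1
    have hs : sin φ ≤ sin halfTet :=
      strictMonoOn_sin.monotoneOn ⟨by linarith [pi_pos], hlt.le⟩
        ⟨by linarith [halfTet_pos, pi_pos], halfTet_lt.le⟩ h1
    rw [cos_halfTet] at hc
    nlinarith


/-! ### Parts 4–5. The two one-dimensional integrals -/

/-- An antiderivative of `ρ √(1 − ρ²) − u ρ²` on `(−1, 1)`: `−(1 − ρ²)^{3/2}/3 − u ρ³/3`.
[folklore] -/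
theorem hasDerivAt_radial (u : ℝ) {ρ : ℝ} (hρ : ρ ^ 2 < 1) :
    HasDerivAt (fun ρ => -(1 - ρ ^ 2) * √(1 - ρ ^ 2) / 3 - u * ρ ^ 3 / 3)
      (ρ * (√(1 - ρ ^ 2) - u * ρ)) ρ := by
  have h1 : 0 < 1 - ρ ^ 2 := by linarith
  set s := √(1 - ρ ^ 2) with hs
  have hspos : 0 < s := sqrt_pos.2 h1
  have hs2 : s ^ 2 = 1 - ρ ^ 2 := sq_sqrt h1.le
  have hf : HasDerivAt (fun ρ : ℝ => 1 - ρ ^ 2) (-(2 * ρ)) ρ := by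
    simpa using (hasDerivAt_pow 2 ρ).const_sub 1
  have hsq : HasDerivAt (fun ρ : ℝ => √(1 - ρ ^ 2)) (-(2 * ρ) / (2 * s)) ρ := hf.sqrt h1.ne'
  have hG := ((hf.neg.mul hsq).div_const 3).sub ((hasDerivAt_pow 3 ρ).const_mul u |>.div_const 3)
  refine hG.congr_deriv ?_
  simp only [Pi.neg_apply]
  rw [← hs]
  norm_num
  field_simp
  linear_combination (-ρ) * hs2

/-- **The radial integral**: for `u > 0`, `∫₀^∞ (ρ √(1 − ρ²) − u ρ²)₊ dρ = (1 − u/√(1 + u²))/3`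
(the integrand is non-negative exactly up to `ρ = 1/√(1 + u²)`). [folklore] -/
theorem radial_lintegral {u : ℝ} (hu : 0 < u) :
    ∫⁻ ρ in Ioi (0 : ℝ), ENNReal.ofReal (ρ * (√(1 - ρ ^ 2) - u * ρ)) =
      ENNReal.ofReal ((1 - u / √(1 + u ^ 2)) / 3) := by
  have hwpos : 0 < √(1 + u ^ 2) := by positivity
  have hw2 : √(1 + u ^ 2) ^ 2 = 1 + u ^ 2 := sq_sqrt (by positivity)
  have hw1 : 1 < √(1 + u ^ 2) := by nlinarith
  set ρm := (√(1 + u ^ 2))⁻¹ with hρm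
  have hρmpos : 0 < ρm := by positivity
  have hρmw : ρm * √(1 + u ^ 2) = 1 := inv_mul_cancel₀ hwpos.ne'
  have hρm2 : ρm ^ 2 * (1 + u ^ 2) = 1 := by rw [← hw2]; nlinarith [hρmw]
  have hρmlt : ρm < 1 := inv_lt_one_of_one_lt₀ hw1
  set h : ℝ → ℝ := fun ρ => ρ * (√(1 - ρ ^ 2) - u * ρ) with hh
  -- split the domain
  rw [← Ioc_union_Ioi_eq_Ioi hρmpos.le, lintegral_union measurableSet_Ioi (Ioc_disjoint_Ioi le_rfl)]
  -- the second part vanishes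
  have hzero : ∫⁻ ρ in Ioi ρm, ENNReal.ofReal (h ρ) = 0 := by
    rw [setLIntegral_congr_fun measurableSet_Ioi (fun ρ hρ => ?_)]
    · exact lintegral_zero
    rw [ENNReal.ofReal_eq_zero]
    have hρ' : ρm < ρ := hρ
    have hρpos : 0 < ρ := hρmpos.trans hρ'
    have h3 : 1 < (1 + u ^ 2) * ρ ^ 2 := by
      have : ρm ^ 2 < ρ ^ 2 := pow_lt_pow_left₀ hρ' hρmpos.le two_ne_zero
      nlinarith
    have h1 : √(1 - ρ ^ 2) ≤ u * ρ := by
      calc √(1 - ρ ^ 2) ≤ √((u * ρ) ^ 2) := sqrt_le_sqrt (by nlinarith)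
        _ = u * ρ := sqrt_sq (by positivity)
    show ρ * (√(1 - ρ ^ 2) - u * ρ) ≤ 0
    nlinarith
  rw [hzero, add_zero]
  -- the first part is a genuine integral
  have hcont : Continuous h := by rw [hh]; fun_prop
  have hnonneg : ∀ ρ ∈ Icc 0 ρm, 0 ≤ h ρ := by
    intro ρ hρ
    have hρ1 : ρ ^ 2 ≤ ρm ^ 2 := pow_le_pow_left₀ hρ.1 hρ.2 2
    have h1 : u * ρ ≤ √(1 - ρ ^ 2) := by
      rw [show u * ρ = √((u * ρ) ^ 2) by rw [sqrt_sq (by nlinarith [hρ.1])]]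
      exact sqrt_le_sqrt (by nlinarith)
    exact mul_nonneg hρ.1 (by linarith)
  have hIoc : ∫⁻ ρ in Ioc 0 ρm, ENNReal.ofReal (h ρ) = ENNReal.ofReal (∫ ρ in (0 : ℝ)..ρm, h ρ) := by
    rw [intervalIntegral.integral_of_le hρmpos.le, ← ofReal_integral_eq_lintegral_ofReal]
    · exact (hcont.integrableOn_Icc).mono_set Ioc_subset_Icc_self
    · rw [Filter.EventuallyLE, ae_restrict_iff' measurableSet_Ioc]
      exact ae_of_all _ fun ρ hρ => hnonneg ρ (Ioc_subset_Icc_self hρ)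
  rw [hIoc]
  congr 1
  -- evaluate by the fundamental theorem of calculus
  rw [intervalIntegral.integral_eq_sub_of_hasDerivAt (f := fun ρ => -(1 - ρ ^ 2) * √(1 - ρ ^ 2) / 3 - u * ρ ^ 3 / 3)]
  · -- the value
    have h1m : 1 - ρm ^ 2 = (u * ρm) ^ 2 := by nlinarith
    have hsq : √(1 - ρm ^ 2) = u * ρm := by rw [h1m, sqrt_sq (by positivity)]
    simp only [hsq]
    rw [show u / √(1 + u ^ 2) = u * ρm by rw [hρm, div_eq_mul_inv]]
    simp
    nlinarith [hρm2]
  · intro ρ hρ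
    rw [uIcc_of_le hρmpos.le] at hρ
    apply hasDerivAt_radial
    have : ρ ^ 2 ≤ ρm ^ 2 := pow_le_pow_left₀ hρ.1 hρ.2 2
    nlinarith
  · exact hcont.intervalIntegrable _ _


/-- The angular antiderivative `(φ − arcsin ((√3/2) sin φ))/3` of
`(1 − √3 cos φ/√(1 + 3 cos² φ))/3`. [folklore] -/
theorem hasDerivAt_angular (φ : ℝ) :
    HasDerivAt (fun φ => (φ - arcsin (√3 / 2 * sin φ)) / 3)
      ((1 - √3 * cos φ / √(1 + (√3 * cos φ) ^ 2)) / 3) φ := by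
  have h3 : (√3) ^ 2 = 3 := sq_sqrt (by norm_num)
  have hx1 : √3 / 2 * sin φ < 1 := by
    have : √3 / 2 < 1 := by
      rw [div_lt_one (by norm_num), show (2:ℝ) = √(2 ^ 2) by rw [sqrt_sq (by norm_num)]]
      exact sqrt_lt_sqrt (by norm_num) (by norm_num)
    have := sin_le_one φ
    nlinarith [sqrt_nonneg 3]
  have hx2 : -1 < √3 / 2 * sin φ := by
    have : √3 / 2 < 1 := by
      rw [div_lt_one (by norm_num), show (2:ℝ) = √(2 ^ 2) by rw [sqrt_sq (by norm_num)]]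
      exact sqrt_lt_sqrt (by norm_num) (by norm_num)
    have := neg_one_le_sin φ
    nlinarith [sqrt_nonneg 3]
  have hinner : HasDerivAt (fun φ => √3 / 2 * sin φ) (√3 / 2 * cos φ) φ :=
    (hasDerivAt_sin φ).const_mul _
  have harc := (hasDerivAt_arcsin hx2.ne' hx1.ne).comp φ hinner
  have hG := ((hasDerivAt_id φ).sub harc).div_const 3
  refine hG.congr_deriv ?_
  -- simplify the derivative
  have hden : √(1 - (√3 / 2 * sin φ) ^ 2) = √(1 + (√3 * cos φ) ^ 2) / 2 := by
    rw [show 1 - (√3 / 2 * sin φ) ^ 2 = (1 + (√3 * cos φ) ^ 2) / 2 ^ 2 by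
      nlinarith [sin_sq_add_cos_sq φ, h3], sqrt_div (by positivity), sqrt_sq (by norm_num)]
  have hpos : 0 < √(1 + (√3 * cos φ) ^ 2) := by positivity
  rw [hden]
  field_simp

/-- **The angular integral**: `∫₀^{θ/2} (1 − √3 cos φ/√(1 + 3 cos² φ))/3 dφ = (3θ − π)/18`.
[folklore] -/
theorem angular_lintegral :
    ∫⁻ φ in Icc 0 halfTet, ENNReal.ofReal ((1 - √3 * cos φ / √(1 + (√3 * cos φ) ^ 2)) / 3) =
      ENNReal.ofReal ((3 * tetDihedralAngle - π) / 18) := by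
  set g : ℝ → ℝ := fun φ => (1 - √3 * cos φ / √(1 + (√3 * cos φ) ^ 2)) / 3 with hg
  have hcont : Continuous g := by
    rw [hg]
    refine Continuous.div_const (continuous_const.sub (Continuous.div (by fun_prop) (by fun_prop)
      fun φ => (by positivity : (0:ℝ) < √(1 + (√3 * cos φ) ^ 2)).ne')) 3
  have hnonneg : ∀ φ, 0 ≤ g φ := by
    intro φ
    have hpos : 0 < √(1 + (√3 * cos φ) ^ 2) := by positivity
    have hle : √3 * cos φ ≤ √(1 + (√3 * cos φ) ^ 2) := by
      calc √3 * cos φ ≤ |√3 * cos φ| := le_abs_self _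
        _ = √((√3 * cos φ) ^ 2) := (sqrt_sq_eq_abs _).symm
        _ ≤ √(1 + (√3 * cos φ) ^ 2) := sqrt_le_sqrt (by linarith)
    show 0 ≤ (1 - √3 * cos φ / √(1 + (√3 * cos φ) ^ 2)) / 3
    have : √3 * cos φ / √(1 + (√3 * cos φ) ^ 2) ≤ 1 := by rwa [div_le_one hpos]
    linarith
  rw [← ofReal_integral_eq_lintegral_ofReal (hcont.integrableOn_Icc) (ae_of_all _ hnonneg),
    integral_Icc_eq_integral_Ioc, ← intervalIntegral.integral_of_le halfTet_pos.le,
    intervalIntegral.integral_eq_sub_of_hasDerivAt (fun φ _ => hasDerivAt_angular φ)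
      (hcont.intervalIntegrable _ _)]
  congr 1
  simp only [sin_zero, mul_zero, arcsin_zero, sub_zero, zero_div]
  rw [sin_halfTet, show √3 / 2 * (√3)⁻¹ = 1 / 2 by field_simp]
  have : arcsin (1 / 2) = π / 6 := by
    rw [show (1:ℝ) / 2 = sin (π / 6) by rw [sin_pi_div_six]]
    exact arcsin_sin (by linarith [pi_pos]) (by linarith [pi_pos])
  rw [this]
  unfold halfTet
  ring


/-! ### Part 1. The region in coordinates -/

/-- The coordinate map `p ↦ (p₀, (p₁, p₂))`. [folklore] -/
def coordMap (p : E3) : ℝ × ℝ × ℝ := (p 0, p 1, p 2)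

/-- The coordinate map preserves Lebesgue measure. [folklore] -/
theorem measurePreserving_coordMap : MeasurePreserving coordMap volume volume := by
  have h1 := EuclideanSpace.volume_preserving_symm_measurableEquiv_toLp (Fin 3)
  have h2 := volume_preserving_piFinSuccAbove (fun _ : Fin 3 => ℝ) 0
  have h3 : MeasurePreserving (Prod.map id MeasurableEquiv.finTwoArrow)
      (volume : Measure (ℝ × (Fin 2 → ℝ))) volume :=
    (MeasurePreserving.id volume).prod (volume_preserving_finTwoArrow ℝ)
  have h := (h3.comp h2).comp h1
  have he : coordMap = (Prod.map id MeasurableEquiv.finTwoArrow) ∘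
      (MeasurableEquiv.piFinSuccAbove (fun _ : Fin 3 => ℝ) 0) ∘
      (MeasurableEquiv.toLp 2 (Fin 3 → ℝ)).symm := by
    funext p
    simp [coordMap, MeasurableEquiv.piFinSuccAbove_apply, Fin.insertNthEquiv,
      MeasurableEquiv.finTwoArrow, Fin.tail]
  rw [he]; exact h


/-- `B(0,1) ∩ T_g` in coordinates: `{x² + y² + z² < 1, 0 ≤ z, √2 z ≤ y, √3 y ≤ x}`. [folklore] -/
def sectorRegion : Set (ℝ × ℝ × ℝ) :=
  {q | q.1 ^ 2 + q.2.1 ^ 2 + q.2.2 ^ 2 < 1 ∧ 0 ≤ q.2.2 ∧ √2 * q.2.2 ≤ q.2.1 ∧ √3 * q.2.1 ≤ q.1}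

/-- The region is measurable. [folklore] -/
theorem measurableSet_sectorRegion : MeasurableSet sectorRegion := by
  have e : sectorRegion = {q : ℝ × ℝ × ℝ | q.1 ^ 2 + q.2.1 ^ 2 + q.2.2 ^ 2 < 1} ∩ {q | 0 ≤ q.2.2} ∩
      {q | √2 * q.2.2 ≤ q.2.1} ∩ {q | √3 * q.2.1 ≤ q.1} := by
    ext q; simp [sectorRegion, and_assoc]
  rw [e]
  refine (((measurableSet_lt ?_ ?_).inter (measurableSet_le ?_ ?_)).inter
    (measurableSet_le ?_ ?_)).inter (measurableSet_le ?_ ?_)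
  all_goals fun_prop

/-- Coordinates of `L_g t`: `(t₁ + t₂ + t₃, (t₂ + t₃)/√3, t₃/√6)`. [folklore] -/
theorem edgeMap_orthoscheme_apply (t : E3) (i : Fin 3) :
    edgeMap rogersOrthoscheme t i =
      ![t 0 + t 1 + t 2, (t 1 + t 2) * (√3)⁻¹, t 2 * (√6)⁻¹] i := by
  rw [edgeMap_apply]
  fin_cases i <;> simp [rogersOrthoscheme, Fin.sum_univ_three]
  ring

/-- `p ∈ B(0,1) ↔ p₀² + p₁² + p₂² < 1`. [folklore] -/
theorem mem_ball_zero_iff_three (p : E3) :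
    p ∈ Metric.ball (0 : E3) 1 ↔ p 0 ^ 2 + p 1 ^ 2 + p 2 ^ 2 < 1 := by
  have h : ‖p‖ ^ 2 = p 0 ^ 2 + p 1 ^ 2 + p 2 ^ 2 := by
    rw [EuclideanSpace.norm_eq, sq_sqrt (Finset.sum_nonneg fun i _ => sq_nonneg _),
      Fin.sum_univ_three]
    simp [Real.norm_eq_abs, sq_abs]
  rw [mem_ball_zero_iff, ← h, ← sq_lt_one_iff₀ (norm_nonneg _)]

/-- **`B(0,1) ∩ T_g` in coordinates**: the ball cut by the cone `0 ≤ √2 z ≤ y ≤ x/√3` (the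
fourth facet `x = t₁ + t₂ + t₃ ≤ 1` of `T_g` is implied by `‖p‖ < 1`). [folklore] -/
theorem ball_inter_orthoscheme_eq_preimage :
    Metric.ball (0 : E3) 1 ∩ rogersSimplex 0 rogersOrthoscheme = coordMap ⁻¹' sectorRegion := by
  have h3 : 0 < √3 := by positivity
  have h2 : 0 < √2 := by positivity
  have h36 : √6 = √3 * √2 := by rw [← sqrt_mul (by norm_num)]; norm_num
  ext p
  simp only [mem_inter_iff, mem_ball_zero_iff_three, mem_preimage, sectorRegion, mem_setOf_eq,
    coordMap, rogersSimplex_zero, mem_image]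
  constructor
  · rintro ⟨hball, t, ⟨ht0, ht1⟩, rfl⟩
    simp only [edgeMap_orthoscheme_apply] at hball ⊢
    simp only [Matrix.cons_val_zero, Matrix.cons_val_one, Matrix.cons_val_two, Matrix.head_cons,
      Matrix.tail_cons, Nat.succ_eq_add_one, Nat.reduceAdd] at hball ⊢
    refine ⟨hball, ?_, ?_, ?_⟩
    · exact mul_nonneg (ht0 2) (by positivity)
    · rw [h36]
      have := ht0 1
      field_simp
      linarith
    · field_simp
      linarith [ht0 0]
  · rintro ⟨hball, hz, hyz, hxy⟩
    refine ⟨hball, !₂[p 0 - √3 * p 1, √3 * p 1 - √6 * p 2, √6 * p 2], ⟨?_, ?_⟩, ?_⟩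
    · intro i
      fin_cases i
      · simp; linarith
      · simp; rw [h36]; nlinarith
      · simp; positivity
    · simp [Fin.sum_univ_three]
      nlinarith [sq_nonneg (p 1), sq_nonneg (p 2)]
    · ext i
      rw [edgeMap_orthoscheme_apply]
      fin_cases i
      · simp
      · simp; field_simp
      · simp; field_simp



/-! ### Parts 2–3. Fubini in `x`, polar coordinates in `(y, z)` -/

/-- The planar window `{0 ≤ z, √2 z ≤ y}`. [folklore] -/
def window : Set (ℝ × ℝ) := {q | 0 ≤ q.2 ∧ √2 * q.2 ≤ q.1}

/-- The `x`-slices of the region inside the window are the intervals `[√3 y, √(1 − y² − z²))`.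
[folklore] -/
theorem slice_sectorRegion_of_mem {q : ℝ × ℝ} (hq : q ∈ window) :
    (fun x : ℝ => (x, q)) ⁻¹' sectorRegion = Ico (√3 * q.1) (√(1 - q.1 ^ 2 - q.2 ^ 2)) := by
  have hy : 0 ≤ q.1 := le_trans (mul_nonneg (sqrt_nonneg _) hq.1) hq.2
  ext x
  simp only [sectorRegion, mem_preimage, mem_setOf_eq, mem_Ico]
  constructor
  · rintro ⟨hb, -, -, hxy⟩
    have hx : 0 ≤ x := le_trans (mul_nonneg (sqrt_nonneg 3) hy) hxy
    refine ⟨hxy, ?_⟩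
    rw [lt_sqrt hx]; linarith
  · rintro ⟨hxy, hxs⟩
    have hx : 0 ≤ x := le_trans (mul_nonneg (sqrt_nonneg 3) hy) hxy
    refine ⟨?_, hq.1, hq.2, hxy⟩
    have := (lt_sqrt hx).1 hxs; linarith

/-- The `x`-slices of the region outside the window are empty. [folklore] -/
theorem slice_sectorRegion_of_not_mem {q : ℝ × ℝ} (hq : q ∉ window) :
    (fun x : ℝ => (x, q)) ⁻¹' sectorRegion = ∅ := by
  ext x
  simp only [sectorRegion, mem_preimage, mem_setOf_eq, mem_empty_iff_false, iff_false, not_and]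
  exact fun _ hz hyz _ => hq ⟨hz, hyz⟩

/-- The slice lengths `(√(1 − y² − z²) − √3 y)₊` on the window. [folklore] -/
theorem volume_slice_sectorRegion (q : ℝ × ℝ) :
    volume ((fun x : ℝ => (x, q)) ⁻¹' sectorRegion) =
      window.indicator (fun q => ENNReal.ofReal (√(1 - q.1 ^ 2 - q.2 ^ 2) - √3 * q.1)) q := by
  by_cases hq : q ∈ window
  · rw [slice_sectorRegion_of_mem hq, indicator_of_mem hq, volume_Ico]
  · rw [slice_sectorRegion_of_not_mem hq, indicator_of_notMem hq, measure_empty]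

/-- Integrating out `x` (Fubini). [folklore] -/
theorem volume_sectorRegion_eq_lintegral :
    volume sectorRegion = ∫⁻ q : ℝ × ℝ,
      window.indicator (fun q => ENNReal.ofReal (√(1 - q.1 ^ 2 - q.2 ^ 2) - √3 * q.1)) q := by
  rw [show (volume : Measure (ℝ × ℝ × ℝ)) = volume.prod volume from rfl,
    Measure.prod_apply_symm measurableSet_sectorRegion]
  simp_rw [volume_slice_sectorRegion]

/-- The integrand in polar coordinates `(ρ, φ)`: `ρ (√(1 − ρ²) − √3 ρ cos φ)₊` on `0 ≤ φ ≤ θ/2`.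
[folklore] -/
def polarIntegrand (p : ℝ × ℝ) : ℝ≥0∞ :=
  (univ ×ˢ Icc 0 halfTet : Set (ℝ × ℝ)).indicator
    (fun p => ENNReal.ofReal (p.1 * (√(1 - p.1 ^ 2) - √3 * cos p.2 * p.1))) p

/-- The polar integrand is measurable. [folklore] -/
theorem measurable_polarIntegrand : Measurable polarIntegrand := by
  refine Measurable.indicator ?_ (MeasurableSet.univ.prod measurableSet_Icc)
  fun_prop

/-- On the polar target the pulled-back integrand is `polarIntegrand`. [folklore] -/
theorem polar_integrand_eq (p : ℝ × ℝ) (hp : p ∈ polarCoord.target) :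
    ENNReal.ofReal p.1 • window.indicator
        (fun q : ℝ × ℝ => ENNReal.ofReal (√(1 - q.1 ^ 2 - q.2 ^ 2) - √3 * q.1)) (polarCoord.symm p) =
      polarIntegrand p := by
  rw [polarCoord_target] at hp
  obtain ⟨hρ, hφ⟩ := mem_prod.1 hp
  have hρ' : 0 < p.1 := hρ
  rw [polarCoord_symm_apply, smul_eq_mul, polarIntegrand]
  have hwin : (p.1 * cos p.2, p.1 * sin p.2) ∈ window ↔ p.2 ∈ Icc 0 halfTet := by
    rw [← window_iff hφ]
    simp only [window, mem_setOf_eq]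
    constructor
    · rintro ⟨h1, h2⟩
      exact ⟨nonneg_of_mul_nonneg_right (by linarith) hρ', le_of_mul_le_mul_left (by linarith) hρ'⟩
    · rintro ⟨h1, h2⟩
      exact ⟨mul_nonneg hρ'.le h1, by nlinarith⟩
  by_cases hφ0 : p.2 ∈ Icc 0 halfTet
  · rw [indicator_of_mem (hwin.2 hφ0), indicator_of_mem (mem_prod.2 ⟨mem_univ _, hφ0⟩),
      ← ENNReal.ofReal_mul hρ'.le]
    congr 1
    have : 1 - (p.1 * cos p.2) ^ 2 - (p.1 * sin p.2) ^ 2 = 1 - p.1 ^ 2 := by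
      nlinarith [sin_sq_add_cos_sq p.2]
    rw [this]; ring
  · rw [indicator_of_notMem (fun h => hφ0 (hwin.1 h)),
      indicator_of_notMem (fun h => hφ0 (mem_prod.1 h).2), mul_zero]

/-- The radial integrals, angle by angle. [folklore] -/
theorem lintegral_polarIntegrand_radial (φ : ℝ) :
    ∫⁻ ρ in Ioi 0, polarIntegrand (ρ, φ) =
      (Icc 0 halfTet).indicator
        (fun φ => ENNReal.ofReal ((1 - √3 * cos φ / √(1 + (√3 * cos φ) ^ 2)) / 3)) φ := by
  by_cases hφ : φ ∈ Icc 0 halfTet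
  · rw [indicator_of_mem hφ]
    have hcos : 0 < cos φ := cos_pos_of_mem_Ioo ⟨by linarith [hφ.1, pi_pos],
      lt_of_le_of_lt hφ.2 halfTet_lt⟩
    have hu : 0 < √3 * cos φ := by positivity
    rw [← radial_lintegral hu]
    refine setLIntegral_congr_fun measurableSet_Ioi fun ρ _ => ?_
    rw [polarIntegrand, indicator_of_mem (mem_prod.2 ⟨mem_univ _, hφ⟩)]
  · rw [indicator_of_notMem hφ]
    rw [setLIntegral_congr_fun measurableSet_Ioi (g := fun _ => 0) fun ρ _ => ?_]
    · exact lintegral_zero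
    rw [polarIntegrand, indicator_of_notMem (fun h => hφ (mem_prod.1 h).2)]

/-- The planar integral in polar coordinates equals `(3θ − π)/18`. [folklore] -/
theorem lintegral_window :
    ∫⁻ q : ℝ × ℝ, window.indicator
        (fun q => ENNReal.ofReal (√(1 - q.1 ^ 2 - q.2 ^ 2) - √3 * q.1)) q =
      ENNReal.ofReal ((3 * tetDihedralAngle - π) / 18) := by
  rw [← lintegral_comp_polarCoord_symm,
    setLIntegral_congr_fun polarCoord.open_target.measurableSet polar_integrand_eq,
    polarCoord_target, show (volume : Measure (ℝ × ℝ)) = volume.prod volume from rfl,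
    ← Measure.prod_restrict, lintegral_prod_symm _ measurable_polarIntegrand.aemeasurable]
  simp_rw [lintegral_polarIntegrand_radial]
  have hsub : Icc 0 halfTet ⊆ Ioo (-π) π := fun φ hφ =>
    ⟨by linarith [hφ.1, pi_pos], by linarith [hφ.2, halfTet_lt, pi_pos]⟩
  rw [lintegral_indicator measurableSet_Icc, Measure.restrict_restrict measurableSet_Icc,
    inter_eq_left.2 hsub, angular_lintegral]

/-- **The sector volume**: `vol(B(0,1) ∩ T_g) = (3θ − π)/18` (`≈ 0.030627`; with
`vol T_g = √2/36` the ratio is `√2 (3θ − π) = σ₃ ≈ 0.7796`). [cite: Rogers1964, Ch. 7 §4 and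
Introduction §3 (`σ₃ = √18 (cos⁻¹ ⅓ − π/3)`)] -/
theorem volume_ball_inter_rogersOrthoscheme :
    volume (Metric.ball (0 : E3) 1 ∩ rogersSimplex 0 rogersOrthoscheme) =
      ENNReal.ofReal ((3 * tetDihedralAngle - π) / 18) := by
  rw [ball_inter_orthoscheme_eq_preimage,
    measurePreserving_coordMap.measure_preimage measurableSet_sectorRegion.nullMeasurableSet,
    volume_sectorRegion_eq_lintegral, lintegral_window]


/-- **DISCHARGE of the named fact `Rogers1964_orthoschemeSectorVolume`**: the unit ball at the
apex covers volume `(3θ − π)/18` of the canonical orthoscheme. [cite: Rogers1964, Ch. 7 §4 and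
Introduction §3] -/
theorem Rogers1964_orthoschemeSectorVolume_holds : Rogers1964_orthoschemeSectorVolume :=
  volume_ball_inter_rogersOrthoscheme

/-- Hence Rogers's bound follows from the dissection fact alone. [cite: Rogers1964, Ch. 7,
Theorem 7.1] -/
theorem Rogers1958_bound_of_dissection (hD : Rogers1964_dissection) : Rogers1958_bound :=
  Rogers1958_bound_of_parts hD Rogers1964_orthoschemeSectorVolume_holds

end Literature.Barriers.AtomisticToContinuum

end
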